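import Mathlib
import Summits.MatrixMultiplication.MatrixMultiplication.Theorems.SoloBlindFlatSound
import Summits.MatrixMultiplication.MatrixMultiplication.Theorems.SoloBlindTypeModelTwo
import Summits.MatrixMultiplication.MatrixMultiplication.Theorems.SoloBlindCorankLeFourRank
import Summits.MatrixMultiplication.MatrixMultiplication.Theorems.SoloBlindCorankLeThree

/-!
# K♭ / E♭ at bounded corank from a flat certificate

The FLAT CERTIFICATE `soloBlindFlatCertified c S`: for every number of letters `m ≤ c` and both
modes, every admissible canonical sub-family of `range (2^m)` is accepted by the checker
`soloBlindFlatFamCheck` at scale `S` (stated in chunks by family code, to be established by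
`native_decide` elsewhere).  MAIN THEOREM (`soloBlind_flat_of_certified`, plain Lean): a flat
certificate up to `c` letters gives CONJECTURE K♭ — `K(τ; S₀) ≤ 1 + 2^{-ρ} - 2^{ρ-c}` — and, for
`H`-good `τ`, CONJECTURE E♭, for every `h` zero-sum free on `S₀` with `|S₀| ≤ dim span h(S₀) + c`
(corank at most `c`, every rank).  The proof is a strong induction on `|S₀|`: index sets not meeting
the hypotheses of `soloBlind_flatSound_K/E` (core inside the letters, an unused letter, at most one
representation) reduce to a smaller index set containing the core or are settled directly.
-/

namespace Summit.MatrixMultiplication.MatrixMultiplication.Theorems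

open Finset Module

/-! ## The certificate -/

/-- Chunk `i` of `n` of the flat certificate for `m` letters at scale `S` in mode `modeE`: every
admissible canonical sub-family of `range (2^m)` with family code `≡ i (mod n)` is accepted. -/
def soloBlindFlatCertCanon (m n i S : ℕ) (modeE : Bool) : Bool :=
  (List.range (2 ^ m)).sublists.all fun F =>
    !(soloBlindFlatAdmissible m F && decide (soloBlindFamCode F % n = i) &&
        soloBlindCanonB m (soloBlindPermTabs m) F) ||
      soloBlindFlatFamCheck (soloBlindMkFlatTabs m) m S F modeE

/-- THE FLAT CERTIFICATE up to `c` letters at scale `S`: for every `m ≤ c` and both modes a complete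
set of chunks holds. -/
def soloBlindFlatCertified (c S : ℕ) : Prop :=
  ∀ m ≤ c, ∀ modeE : Bool, ∃ n, 0 < n ∧ ∀ i < n, soloBlindFlatCertCanon m n i S modeE = true

/-- Extraction from a complete set of chunks. -/
theorem soloBlind_flatCertCanon_extract {m n S : ℕ} {modeE : Bool} (hn : 0 < n)
    (h : ∀ i < n, soloBlindFlatCertCanon m n i S modeE = true) {F : List ℕ}
    (hsub : F.Sublist (List.range (2 ^ m))) (hadm : soloBlindFlatAdmissible m F = true)
    (hcanon : soloBlindCanonB m (soloBlindPermTabs m) F = true) :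
    soloBlindFlatFamCheck (soloBlindMkFlatTabs m) m S F modeE = true := by
  have hc := h _ (Nat.mod_lt (soloBlindFamCode F) hn)
  unfold soloBlindFlatCertCanon at hc
  rw [List.all_eq_true] at hc
  have hF := hc F (List.mem_sublists.mpr hsub)
  simpa [hadm, hcanon] using hF

/-! ## Configuration lemmas -/

variable {G : Type*} [AddCommGroup G] [DecidableEq G] {ι : Type*} [DecidableEq ι]

/-- Restricting the index set to one containing the core keeps all representations. -/
theorem soloBlind_repAll_restrict {h : ι → G} {S S' : Finset ι} {τ : G}
    (hcore : soloBlindCore h S τ ⊆ S') (hS' : S' ⊆ S) :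
    soloBlindSeqRepAll h S' τ = soloBlindSeqRepAll h S τ := by
  ext T
  rw [soloBlind_mem_seqRepAll, soloBlind_mem_seqRepAll]
  constructor
  · rintro ⟨hT, hs⟩
    exact ⟨hT.trans hS', hs⟩
  · rintro ⟨hT, hs⟩
    exact ⟨fun y hy => hcore (soloBlind_mem_core.2 ⟨T, soloBlind_mem_seqRepAll.2 ⟨hT, hs⟩, hy⟩), hs⟩

/-- K♭ is invariant under such a restriction. -/
theorem soloBlind_kflatAt_restrict [Module (ZMod 3) G] {h : ι → G} {S S' : Finset ι} {τ : G}
    (hcore : soloBlindCore h S τ ⊆ S') (hS' : S' ⊆ S) :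
    soloBlindKFlatAt h S' τ ↔ soloBlindKFlatAt h S τ := by
  unfold soloBlindKFlatAt soloBlindCoreRank soloBlindCore soloBlindMass
  rw [soloBlind_repAll_restrict hcore hS']

/-- E♭ is invariant under such a restriction. -/
theorem soloBlind_eflatAt_restrict [Module (ZMod 3) G] {h : ι → G} {S S' : Finset ι} {τ : G}
    (hcore : soloBlindCore h S τ ⊆ S') (hS' : S' ⊆ S) :
    soloBlindEFlatAt h S' τ ↔ soloBlindEFlatAt h S τ := by
  unfold soloBlindEFlatAt soloBlindCoreRank soloBlindCore soloBlindMass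
  rw [soloBlind_repAll_restrict hcore hS']

/-- DECOMPOSITION of a representation over `B ∪ X` into its letter mask (a member of the exact family)
and its block part. -/
theorem soloBlind_rep_decompose {h : ι → G} {B : Finset ι} {m : ℕ} (x : Fin m ↪ ι) {τ : G}
    {T : Finset ι} (hT : T ∈ soloBlindSeqRepAll h (B ∪ Finset.univ.map x) τ) :
    ∃ M ∈ soloBlindExactFam h B x τ, T.filter (fun y => y ∉ B) = (soloBlindDecSet m M).map x ∧
      T.filter (fun y => y ∈ B) ∈
        soloBlindSeqRepAll h B (τ - ∑ a ∈ soloBlindDecSet m M, h (x a)) := by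
  obtain ⟨hTS, hsum⟩ := soloBlind_mem_seqRepAll.mp hT
  have hC : T.filter (fun y => y ∉ B) ⊆ Finset.univ.map x := by
    intro y hy
    rw [Finset.mem_filter] at hy
    rcases Finset.mem_union.mp (hTS hy.1) with hyB | hyX
    · exact absurd hyB hy.2
    · exact hyX
  obtain ⟨M, hM, hMC⟩ := soloBlind_exists_mask x hC
  have hsplit := Finset.sum_filter_add_sum_filter_not T (fun y => y ∈ B) h
  have hCsum : ∑ y ∈ T.filter (fun y => y ∉ B), h y = ∑ a ∈ soloBlindDecSet m M, h (x a) := by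
    rw [← hMC, Finset.sum_map]
  have hA : T.filter (fun y => y ∈ B) ∈
      soloBlindSeqRepAll h B (τ - ∑ a ∈ soloBlindDecSet m M, h (x a)) := by
    rw [soloBlind_mem_seqRepAll]
    refine ⟨fun y hy => (Finset.mem_filter.mp hy).2, ?_⟩
    rw [← hsum, ← hsplit, hCsum, add_sub_cancel_right]
  exact ⟨M, soloBlind_mem_exactFam.mpr ⟨hM, ⟨_, hA⟩⟩, hMC.symm, hA⟩

/-- A letter in the core is used by some member of the exact family. -/
theorem soloBlind_used_of_mem_core {h : ι → G} {B : Finset ι} {m : ℕ} (x : Fin m ↪ ι)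
    (hxB : ∀ a, x a ∉ B) {τ : G} {a : Fin m}
    (ha : x a ∈ soloBlindCore h (B ∪ Finset.univ.map x) τ) :
    ∃ M ∈ soloBlindExactFam h B x τ, M.testBit a = true := by
  obtain ⟨T, hT, haT⟩ := soloBlind_mem_core.1 ha
  obtain ⟨M, hM, hC, -⟩ := soloBlind_rep_decompose x hT
  refine ⟨M, hM, ?_⟩
  rw [← soloBlind_mem_decSet]
  have hmem : x a ∈ T.filter (fun y => y ∉ B) := Finset.mem_filter.mpr ⟨haT, hxB a⟩
  rw [hC, Finset.mem_map] at hmem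
  obtain ⟨a', ha', he⟩ := hmem
  rwa [← x.injective he]

/-- An exact family with at most one member carries at most one representation (block `B`
subset-sum distinct). -/
theorem soloBlind_repAll_card_le_one_of_length {h : ι → G} {B : Finset ι}
    (hdist : ∀ A ⊆ B, ∀ A' ⊆ B, ∑ i ∈ A, h i = ∑ i ∈ A', h i → A = A')
    {m : ℕ} (x : Fin m ↪ ι) {τ : G} (hF : (soloBlindExactFam h B x τ).length ≤ 1) :
    (soloBlindSeqRepAll h (B ∪ Finset.univ.map x) τ).card ≤ 1 := by
  rw [Finset.card_le_one]
  intro T hT T' hT'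
  obtain ⟨M, hM, hC, hA⟩ := soloBlind_rep_decompose x hT
  obtain ⟨M', hM', hC', hA'⟩ := soloBlind_rep_decompose x hT'
  have hMM : M = M' := by
    obtain ⟨k, hk, hkM⟩ := List.mem_iff_getElem.mp hM
    obtain ⟨k', hk', hkM'⟩ := List.mem_iff_getElem.mp hM'
    have hk0 : k = 0 := by omega
    have hk0' : k' = 0 := by omega
    subst hk0 hk0'
    rw [← hkM, ← hkM']
  subst hMM
  have hAA : T.filter (fun y => y ∈ B) = T'.filter (fun y => y ∈ B) :=
    Finset.card_le_one.mp (soloBlind_repAll_card_le_one_of_sumDistinct hdist _) _ hA _ hA'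
  rw [← Finset.filter_union_filter_not_eq (fun y => y ∈ B) T,
    ← Finset.filter_union_filter_not_eq (fun y => y ∈ B) T', hAA, hC, hC']

omit [DecidableEq ι] [DecidableEq G] in
/-- A zero-sum-free index set whose values span a rank-zero space is empty. -/
theorem soloBlind_eq_empty_of_finrank_zero [Module (ZMod 3) G] {h : ι → G} {S : Finset ι}
    (h0 : finrank (ZMod 3) (Submodule.span (ZMod 3) (h '' (↑S : Set ι))) = 0)
    (zsf : ∀ T ⊆ S, T.Nonempty → ∑ i ∈ T, h i ≠ 0) : S = ∅ := by
  by_contra hne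
  obtain ⟨i, hi⟩ := Finset.nonempty_iff_ne_empty.mpr hne
  have hhi : h i ≠ 0 := by
    have hz := zsf {i} (Finset.singleton_subset_iff.mpr hi) (Finset.singleton_nonempty i)
    rwa [Finset.sum_singleton] at hz
  haveI := FiniteDimensional.span_of_finite (ZMod 3) (S.finite_toSet.image h)
  have h1 : finrank (ZMod 3) (Submodule.span (ZMod 3) {h i}) ≤
      finrank (ZMod 3) (Submodule.span (ZMod 3) (h '' (↑S : Set ι))) :=
    Submodule.finrank_mono (Submodule.span_mono (Set.singleton_subset_iff.mpr ⟨i, hi, rfl⟩))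
  rw [finrank_span_singleton hhi, h0] at h1
  exact absurd h1 (by norm_num)

/-! ## The main theorem -/

/-- K♭ AND E♭ AT CORANK AT MOST `c` FROM A FLAT CERTIFICATE (every rank), by strong induction on the
size of the index set. -/
theorem soloBlind_flat_of_certified [Module (ZMod 3) G] {c Sc : ℕ} (hcert : soloBlindFlatCertified c Sc)
    (hSc : c + 1 ≤ Sc) (h : ι → G) : ∀ (N : ℕ) (S₀ : Finset ι), S₀.card ≤ N →
      S₀.card ≤ finrank (ZMod 3) (Submodule.span (ZMod 3) (h '' (↑S₀ : Set ι))) + c →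
      (∀ T ⊆ S₀, T.Nonempty → ∑ i ∈ T, h i ≠ 0) → ∀ τ : G,
      soloBlindKFlatAt h S₀ τ ∧ ((∀ T ⊆ S₀, ∑ i ∈ T, h i ≠ τ + τ) → soloBlindEFlatAt h S₀ τ) := by
  intro N
  induction N with
  | zero =>
    intro S₀ hN _ _ τ
    have hS : S₀ = ∅ := Finset.card_eq_zero.mp (Nat.le_zero.mp hN)
    have hR : (soloBlindSeqRepAll h S₀ τ).card ≤ 1 := by
      unfold soloBlindSeqRepAll
      rw [hS, Finset.powerset_empty]
      exact (Finset.card_filter_le _ _).trans (by rw [Finset.card_singleton])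
    exact ⟨soloBlind_kflat_of_card_le_one hR, fun _ => soloBlind_eflat_of_card_le_one hR⟩
  | succ N ih =>
    intro S₀ hN hc zsf τ
    -- at most one representation: settled directly
    by_cases hR : (soloBlindSeqRepAll h S₀ τ).card ≤ 1
    · exact ⟨soloBlind_kflat_of_card_le_one hR, fun _ => soloBlind_eflat_of_card_le_one hR⟩
    -- reduction to a smaller index set containing the core
    have reduce : ∀ S' ⊆ S₀, soloBlindCore h S₀ τ ⊆ S' → S'.card ≤ N →
        S'.card ≤ finrank (ZMod 3) (Submodule.span (ZMod 3) (h '' (↑S' : Set ι))) + c →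
        soloBlindKFlatAt h S₀ τ ∧ ((∀ T ⊆ S₀, ∑ i ∈ T, h i ≠ τ + τ) → soloBlindEFlatAt h S₀ τ) := by
      intro S' hS' hcoreS' hN' hc'
      obtain ⟨hK, hE⟩ := ih S' hN' hc' (fun T hT hne => zsf T (hT.trans hS') hne) τ
      exact ⟨(soloBlind_kflatAt_restrict hcoreS' hS').mp hK, fun hgood =>
        (soloBlind_eflatAt_restrict hcoreS' hS').mp (hE fun T hT => hgood T (hT.trans hS'))⟩
    -- a maximal independent block
    obtain ⟨B, hBS, hliOn, hrankB⟩ := soloBlind_exists_indepOn_spanning h S₀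
    have hli : LinearIndependent (ZMod 3) (fun i : B => h i) := hliOn
    have hdist : ∀ A ⊆ B, ∀ A' ⊆ B, ∑ i ∈ A, h i = ∑ i ∈ A', h i → A = A' :=
      soloBlind_sumDistinct_of_linearIndependent (R := ZMod 3)
        (soloBlind_coeffIndep_of_linearIndepOn hliOn)
    have hBrank : B.card ≤ finrank (ZMod 3) (Submodule.span (ZMod 3) (h '' (↑B : Set ι))) := by
      rw [show h '' (↑B : Set ι) = Set.range (fun i : B => h i) by ext; simp,
        finrank_span_eq_card hli, Fintype.card_coe]
    have hXc : (S₀ \ B).card ≤ c := by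
      rw [Finset.card_sdiff_of_subset hBS]
      omega
    have hcoreS := soloBlind_core_subset h S₀ τ
    -- case: the core misses the block
    by_cases hcoreB : ¬ (soloBlindCore h S₀ τ ∩ B).Nonempty
    · have hcoreX : soloBlindCore h S₀ τ ⊆ S₀ \ B := fun y hy =>
        Finset.mem_sdiff.mpr ⟨hcoreS hy, fun hyB => hcoreB ⟨y, Finset.mem_inter.mpr ⟨hy, hyB⟩⟩⟩
      by_cases heq : soloBlindCore h S₀ τ = S₀
      · -- then `B = ∅`, the span has rank zero and `S₀ = ∅`
        have hB : B = ∅ := by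
          rw [Finset.eq_empty_iff_forall_notMem]
          intro y hyB
          have hy : y ∈ S₀ \ B := hcoreX (by rw [heq]; exact hBS hyB)
          exact (Finset.mem_sdiff.mp hy).2 hyB
        rw [hB, Finset.card_empty, Nat.le_zero] at hrankB
        have hS := soloBlind_eq_empty_of_finrank_zero hrankB zsf
        exfalso
        apply hR
        unfold soloBlindSeqRepAll
        rw [hS, Finset.powerset_empty]
        exact (Finset.card_filter_le _ _).trans (by rw [Finset.card_singleton])
      · have hss : soloBlindCore h S₀ τ ⊂ S₀ := Finset.ssubset_iff_subset_ne.mpr ⟨hcoreS, heq⟩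
        have hlt := Finset.card_lt_card hss
        exact reduce _ hcoreS (subset_refl _) (by omega)
          ((Finset.card_le_card hcoreX).trans (hXc.trans (Nat.le_add_left _ _)))
    rw [not_not] at hcoreB
    -- case: an unused letter
    by_cases hused : ¬ ∀ y ∈ S₀ \ B, y ∈ soloBlindCore h S₀ τ
    · obtain ⟨y, hyX, hycore⟩ : ∃ y ∈ S₀ \ B, y ∉ soloBlindCore h S₀ τ := by
        by_contra hcon
        exact hused fun y hy => by_contra fun hyc => hcon ⟨y, hy, hyc⟩
      obtain ⟨hyS, hyB⟩ := Finset.mem_sdiff.mp hyX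
      have hBS' : B ⊆ S₀.erase y := fun z hz =>
        Finset.mem_erase.mpr ⟨fun hzy => hyB (hzy ▸ hz), hBS hz⟩
      haveI := FiniteDimensional.span_of_finite (ZMod 3) ((S₀.erase y).finite_toSet.image h)
      have hmono : finrank (ZMod 3) (Submodule.span (ZMod 3) (h '' (↑B : Set ι))) ≤
          finrank (ZMod 3) (Submodule.span (ZMod 3) (h '' (↑(S₀.erase y) : Set ι))) :=
        Submodule.finrank_mono (Submodule.span_mono (Set.image_mono (Finset.coe_subset.mpr hBS')))
      have hcard := Finset.card_erase_of_mem hyS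
      have hsd := Finset.card_sdiff_of_subset hBS
      exact reduce (S₀.erase y) (Finset.erase_subset y S₀)
        (fun z hz => Finset.mem_erase.mpr ⟨fun hzy => hycore (hzy ▸ hz), hcoreS hz⟩)
        (by omega) (by omega)
    rw [not_not] at hused
    -- main case: canonical relabelling of the letters, then the certificate
    obtain ⟨x, hx⟩ := soloBlind_exists_enum (S₀ \ B)
    obtain ⟨π, hπ⟩ := soloBlind_exists_canon (S₀ \ B).card (soloBlindExactFam h B x τ)
    have hx' : Finset.univ.map (π.toEmbedding.trans x) = S₀ \ B := by
      rw [soloBlind_map_perm_enum, hx]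
    have hxB' : ∀ a, (π.toEmbedding.trans x) a ∉ B := fun a ha => by
      have hxa : (π.toEmbedding.trans x) a ∈ Finset.univ.map (π.toEmbedding.trans x) :=
        Finset.mem_map_of_mem _ (Finset.mem_univ a)
      rw [hx'] at hxa
      exact (Finset.mem_sdiff.mp hxa).2 ha
    have hS₀ : B ∪ Finset.univ.map (π.toEmbedding.trans x) = S₀ := by
      rw [hx', Finset.union_sdiff_of_subset hBS]
    have zsf' : ∀ T ⊆ B ∪ Finset.univ.map (π.toEmbedding.trans x), T.Nonempty → ∑ i ∈ T, h i ≠ 0 := by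
      rw [hS₀]; exact zsf
    have hu' : (soloBlindCore h (B ∪ Finset.univ.map (π.toEmbedding.trans x)) τ ∩ B).Nonempty := by
      rw [hS₀]; exact hcoreB
    by_cases h2 : ¬ 2 ≤ (soloBlindExactFam h B (π.toEmbedding.trans x) τ).length
    · exfalso
      apply hR
      rw [← hS₀]
      exact soloBlind_repAll_card_le_one_of_length hdist _ (by omega)
    rw [not_not] at h2
    have hadm : soloBlindFlatAdmissible (S₀ \ B).card
        (soloBlindExactFam h B (π.toEmbedding.trans x) τ) = true := by
      unfold soloBlindFlatAdmissible
      rw [Bool.and_eq_true, decide_eq_true_eq, List.all_eq_true]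
      refine ⟨h2, fun a ha => ?_⟩
      rw [List.mem_range] at ha
      rw [List.any_eq_true]
      have hxa : (π.toEmbedding.trans x) ⟨a, ha⟩ ∈ soloBlindCore h
          (B ∪ Finset.univ.map (π.toEmbedding.trans x)) τ := by
        have hmem : (π.toEmbedding.trans x) ⟨a, ha⟩ ∈ Finset.univ.map (π.toEmbedding.trans x) :=
          Finset.mem_map_of_mem _ (Finset.mem_univ _)
        rw [hx'] at hmem
        rw [hS₀]
        exact hused _ hmem
      obtain ⟨M, hM, hb⟩ := soloBlind_used_of_mem_core _ hxB' hxa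
      exact ⟨M, hM, hb⟩
    have hcanon : soloBlindCanonB (S₀ \ B).card (soloBlindPermTabs (S₀ \ B).card)
        (soloBlindExactFam h B (π.toEmbedding.trans x) τ) = true := by
      rw [soloBlindExactFam_perm]
      exact hπ
    have hsub := soloBlind_exactFam_sublist h B (π.toEmbedding.trans x) τ
    obtain ⟨nK, hnK, hallK⟩ := hcert _ hXc false
    obtain ⟨nE, hnE, hallE⟩ := hcert _ hXc true
    have hK := soloBlind_flatCertCanon_extract hnK hallK hsub hadm hcanon
    have hE := soloBlind_flatCertCanon_extract hnE hallE hsub hadm hcanon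
    refine ⟨?_, fun hgood => ?_⟩
    · have r := soloBlind_flatSound_K hli hdist _ hxB' τ zsf' (S := Sc) (by omega) hadm hK hu'
      rwa [hS₀] at r
    · have hgood' : ∀ T ⊆ B ∪ Finset.univ.map (π.toEmbedding.trans x), ∑ i ∈ T, h i ≠ τ + τ := by
        rw [hS₀]; exact hgood
      have r := soloBlind_flatSound_E hli hdist _ hxB' τ zsf' hgood' (S := Sc) (by omega) hadm hE hu'
      rwa [hS₀] at r

/-- CONJECTURE K♭ AT CORANK AT MOST `c` from a flat certificate (rank form). -/
theorem soloBlind_kflat_of_certified [Module (ZMod 3) G] {c Sc : ℕ} (hcert : soloBlindFlatCertified c Sc)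
    (hSc : c + 1 ≤ Sc) {h : ι → G} {S : Finset ι}
    (hc : S.card ≤ finrank (ZMod 3) (Submodule.span (ZMod 3) (h '' (↑S : Set ι))) + c)
    (zsf : ∀ T ⊆ S, T.Nonempty → ∑ i ∈ T, h i ≠ 0) (τ : G) : soloBlindKFlatAt h S τ :=
  (soloBlind_flat_of_certified hcert hSc h S.card S le_rfl hc zsf τ).1

/-- CONJECTURE E♭ AT CORANK AT MOST `c` from a flat certificate (rank form, `H`-good `τ`). -/
theorem soloBlind_eflat_of_certified [Module (ZMod 3) G] {c Sc : ℕ} (hcert : soloBlindFlatCertified c Sc)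
    (hSc : c + 1 ≤ Sc) {h : ι → G} {S : Finset ι}
    (hc : S.card ≤ finrank (ZMod 3) (Submodule.span (ZMod 3) (h '' (↑S : Set ι))) + c)
    (zsf : ∀ T ⊆ S, T.Nonempty → ∑ i ∈ T, h i ≠ 0) {τ : G} (hgood : ∀ T ⊆ S, ∑ i ∈ T, h i ≠ τ + τ) :
    soloBlindEFlatAt h S τ :=
  (soloBlind_flat_of_certified hcert hSc h S.card S le_rfl hc zsf τ).2 hgood

end Summit.MatrixMultiplication.MatrixMultiplication.Theorems
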